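import Summits.HodgeConjecture.HodgeConjecture.Theses.NikulinTwinTransport
import Summits.HodgeConjecture.HodgeConjecture.Theorems.NikulinTwinTransportRealMultiplicationGlue
import Literature.AlgebraicGeometry.Surfaces.K3HodgeTypesProofs

/-!
# Route NikulinTwinTransport · the frame item `Assembly` (stmt-HodgeConjecture-13942)

The route's frame item is
`Assembly := TwinSimilitudeAlgebraic → HodgeIsometryAlgebraic → TwinExists → LefschetzOneOneK3 →
SectorComplement → HodgeConjecture` (rev 4: "the frame modulo the formal glue"). Its only exit to
the summit is the declared, not-claimed sector complement `SectorComplement : SquareHodgeOfSqrtTwo →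
HodgeConjecture`, so the item is exactly "X + Buskin + the universal twin + Lefschetz (1,1) give the
sector `SquareHodgeOfSqrtTwo`", i.e. the content of the two glue items `RealMultiplicationGlue`
(stmt-HodgeConjecture-13681) and `SquareGlue` (stmt-HodgeConjecture-13682) in assembled form. This
file records that bookkeeping, kernel-checked and with no hypotheses beyond the route's own
declarations:

* `assembly_of_glue` — pure logic: the two glue decls give the frame
  (`h₇ (squareGlue (realMultiplicationGlue h₂ h₃ h₄ h₁) h₁)`, the planner's GroundCheck3 term); so the
  item closes the day both glue items close, and it is implied by the hypotheses `h₅, h₆` of the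
  route's deciding theorem `closes` (which does not use this decl).
* `squareHodgeOfSqrtTwo_of_hodgeConjecture` — the sector is a special case of the summit.
* `assembly_iff_glue` — the exact content of the item: `Assembly ↔ (X → Buskin → TwinExists →
  L(1,1) → SquareHodgeOfSqrtTwo)`; the frame says no more and no less than the combined glue, so a
  standalone proof is a proof of the sector from X, Buskin, the twin and Lefschetz `(1,1)` — in the
  tree CONDITIONAL on the named facts the glue items carry (markings of K3 surfaces, de Rham's
  theorem, a Hodge model of `S ⊗ S`, the coniveau inclusion `N¹ ⊆ H^{1,1}`, `b₁(K3) = 0`; cf.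
  `assembly_of_squareGlue_of_marking_of_hodgeTypes` in `…RealMultiplicationGlue`).

* `assembly_of_squareGlue_of_marking_of_deRham` — with the landed conditional glue
  `realMultiplicationSqrtTwoAlgebraic_of_marking_of_hodgeTypes` (mirror trick, seat 13681) the frame
  needs, besides `SquareGlue`, only the marking fact `Huybrechts_K3_marking_exists` and de Rham's
  theorem in multiplicative form (`exists_deRhamIsoFamily` on finite-dimensional complex model
  spaces): the Hodge-type fact `Huybrechts_K3_hodgeTypes_H2` used by that glue is itself a
  consequence of these two (`Huybrechts_K3_hodgeTypes_H2_of_marking_of_exists_deRhamIsoFamily`).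

No new definitions, no named facts. Prover seat prover-pitem-stmt-HodgeConjecture-13942-0.
-/

namespace Summit.HodgeConjecture.HodgeConjecture.Theorems.NikulinTwinTransport

/-- **The frame from the two glue items (pure logic).** `RealMultiplicationGlue` turns X, Buskin,
the universal twin and Lefschetz `(1,1)` into `RealMultiplicationSqrtTwoAlgebraic`, `SquareGlue`
adds Lefschetz `(1,1)` once more to reach the sector `SquareHodgeOfSqrtTwo`, and the sector
complement `h₇` carries it to the summit — the planner's term
`fun h₂ h₃ h₄ h₁ h₇ => h₇ (squareGlue (realMultiplicationGlue h₂ h₃ h₄ h₁) h₁)`.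
[cite: Varesco2023, Thm. 2.1 and Rem. 2.2; §2 p. 8] -/
theorem assembly_of_glue
    (hR : Theses.NikulinTwinTransport.RealMultiplicationGlue)
    (hSq : Theses.NikulinTwinTransport.SquareGlue) :
    Theses.NikulinTwinTransport.Assembly :=
  fun h₂ h₃ h₄ h₁ h₇ => h₇ (hSq (hR h₂ h₃ h₄ h₁) h₁)

/-- **The sector is a special case of the summit**: `HodgeConjecture → SquareHodgeOfSqrtTwo`, since
`S ⊗ S` is smooth projective of dimension `2 + 2` (`IsSmoothProjective.tensor_holds`). [folklore] -/
theorem squareHodgeOfSqrtTwo_of_hodgeConjecture (hHC : _root_.HodgeConjecture) :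
    Theses.NikulinTwinTransport.SquareHodgeOfSqrtTwo :=
  fun _ hS _ _ _ _ _ _ _ =>
    hHC (Literature.AlgebraicGeometry.Motives.IsSmoothProjective.tensor_holds hS.1 hS.1)

/-- **Exact content of the frame item.** `Assembly` is equivalent to the combined glue
"X + Buskin + the universal twin + Lefschetz `(1,1)` give the sector `SquareHodgeOfSqrtTwo`":
forwards, if the sector failed then `SectorComplement` would hold vacuously and `Assembly` would
give `HodgeConjecture`, hence the sector (`squareHodgeOfSqrtTwo_of_hodgeConjecture`) — so the sector
holds either way (classical); backwards, compose with the sector complement `h₇`. In particular the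
frame is implied by the two glue items (`assembly_of_glue`) and implies nothing about the summit
beyond them. [folklore] -/
theorem assembly_iff_glue :
    Theses.NikulinTwinTransport.Assembly ↔
      (Theses.NikulinTwinTransport.TwinSimilitudeAlgebraic →
        Theses.NikulinTwinTransport.HodgeIsometryAlgebraic →
        Theses.NikulinTwinTransport.TwinExists →
        Theses.NikulinTwinTransport.LefschetzOneOneK3 →
        Theses.NikulinTwinTransport.SquareHodgeOfSqrtTwo) := by
  constructor
  · intro hA h₂ h₃ h₄ h₁
    by_cases hSq : Theses.NikulinTwinTransport.SquareHodgeOfSqrtTwo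
    · exact hSq
    · exact squareHodgeOfSqrtTwo_of_hodgeConjecture (hA h₂ h₃ h₄ h₁ fun h => absurd h hSq)
  · intro H h₂ h₃ h₄ h₁ h₇
    exact h₇ (H h₂ h₃ h₄ h₁)

section Conditional

open scoped Manifold
open Literature.AlgebraicGeometry.Surfaces
open Literature.NumberTheory.Transcendental (exists_deRhamIsoFamily)

/-- **The frame from `SquareGlue`, markings of K3 surfaces and de Rham's theorem.** Of the frame's
own hypotheses only X (`TwinSimilitudeAlgebraic`, at the pairs `(S, S)`) and Lefschetz `(1,1)` are
used (through `realMultiplicationSqrtTwoAlgebraic_of_marking_of_hodgeTypes`); Buskin's theorem and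
the universal twin are idle. The named inputs are `Huybrechts_K3_marking_exists` (Huybrechts Ch. 1
Prop. 3.5 with Ch. 6 Prop. 1.2) and `exists_deRhamIsoFamily` on every finite-dimensional complex
model space, which together give the Hodge types of `H²(K3)`
(`Huybrechts_K3_hodgeTypes_H2_of_marking_of_exists_deRhamIsoFamily`).
[cite: Varesco2023, Thm. 2.1 and Rem. 2.2] [cite: Huybrechts2016K3, Ch. 1 Prop. 3.5; Ch. 6 Prop. 1.2] -/
theorem assembly_of_squareGlue_of_marking_of_deRham
    (hSq : Theses.NikulinTwinTransport.SquareGlue)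
    (hmark : Huybrechts_K3_marking_exists)
    (hdR : ∀ (E : Type) [NormedAddCommGroup E] [NormedSpace ℂ E] [FiniteDimensional ℂ E],
      exists_deRhamIsoFamily 𝓘(ℝ, E)) :
    Theses.NikulinTwinTransport.Assembly :=
  assembly_of_squareGlue_of_marking_of_hodgeTypes hSq hmark
    (Huybrechts_K3_hodgeTypes_H2_of_marking_of_exists_deRhamIsoFamily hmark hdR)

end Conditional

end Summit.HodgeConjecture.HodgeConjecture.Theorems.NikulinTwinTransport
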